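import Summits.AnomalousDissipation.AnomalousDissipation.Theses.Sparks

/-!
# Birth skeleton (BC3) — crux `Sparks.RecurrentBlowupBall` (stmt-AnomalousDissipation-14546)

Route `AnomalousDissipation/Sparks` (route-AnomalousDissipation-Sparks; `closes : SingularitiesDissipate →
UniformIgnition → RecurrentBlowupBall → IgnitionReturnGlue → Assembly → AnomalousDissipation`), item
stmt-AnomalousDissipation-14546, crux rank 4, "the dynamical heart" (Hyp1 ∧ Hyp3 of the card
sparks-recurrent-calm-forces-euler-blowup for ONE force and ONE ball): there are a smooth steady
divergence-free mean-zero force `f`, a smooth divergence-free exit state `U₀`, radii `0 < δ₂ < δ₁`, a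
blow-up time `T > 0`, an energy cap `E`, a return time `Tr > 0` and `ν₁ > 0` with
(BLOW-UP BALL) no smooth divergence-free `V`, `‖V − U₀‖_{L²} ≤ δ₁`, launches a classical solution of Euler
forced by `f` on `[0, T]`, and (DEEP RETURN) for every `0 < ν < ν₁` some global Leray–Hopf solution of `NS_ν`
forced by `f` keeps `∫|u(t)|² ≤ E` for all `t ≥ 0` and has in every window `[kTr, (k+1)Tr]` a good restart
time `s` (`t ↦ u(s+t)` is global Leray–Hopf from `u s`) with `‖u s − U₀‖_{L²} ≤ δ₂`.
Skeleton registrar planner-skel-stmt-AnomalousDissipation-14546-0, 2026-08-17 (route re-audit bin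
REPAIRABLE; `Cruxes/RecurrentBlowupBall/` had no workfile before this one).

## The cut: SPARK-CYCLE CORE ∣ BALL TRANSPORT ALONG THE BURST ONSET ∣ ENERGY CEILING FROM CALM VISITS

The crux is ONE existential whose two conjuncts share the witnesses `(f, U₀)` and are coupled by
`δ₂ < δ₁` (the return must be DEEPER than the robustness radius). No decomposition into closed statements
separates BALL from RETURN without a shared yardstick: a split "∃ witnesses, BALL ∧ R" / "∀ witnesses,
R → RETURN" is a tautology when `R` is a recurrence clause and a new universal physical claim otherwise
(universal `ν`-uniform recurrence to every robust blow-up state; universal `L²`-openness of breakdown;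
fuse/transit through the charging branch, which costs exactly the `L²`-amplification factor of the
instability — recorded in the seat's NOTES.md as dead seams). What CAN honestly be separated is separated:

* the `ν`-UNIFORM ENERGY CEILING — not automatic for forced Navier–Stokes (laminar and drifting families
  have energy `∼ ν⁻²` resp. arbitrary: the refuted universal ceilings GPEnergyCeiling, stmt-2979, and
  EnsembleCeilingBridge, stmt-2984) but a CONSEQUENCE of recurrence at good restart times to an `L²`-bounded
  set (stub 3, provable now);
* the freedom to place the RETURN TARGET `U₁` UPSTREAM of the breakdown ball along the burst — the card's
  actual picture (returns happen near the charged, nearly laminar state; breakdown develops downstream) —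
  at an explicit price: blow-up balls propagate backwards along classical forced-Euler orbits, shrinking by
  the orbit's `L²`-amplification `e^{Λτ}` (stub 2, provable now: classical–classical relative energy, the
  classical sibling of the route's engine WindowStability, stmt-1186);
* the OPEN RESIDUE (stub 1), stated in the weakest form the composition needs: `ν`-by-`ν`, NO energy clause,
  NO datum, NO Leray–Hopf requirement before the first visit, sliding windows, two states `U₁ —orbit→ U₀` with
  `δ₂ < δ₁e^{−Λτ}` (`τ = 0`, `U₁ = U₀` allowed: the one-state form).

* `stub_sparkCycleCore` (the residue; open, XL). `∃ f U₁ U₀ δ₁ δ₂ T τ Λ L ν₁`: `OrbitInto f U₁ U₀ τ Λ`,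
  `BlowupBall f U₀ δ₁ T`, `0 < δ₂ < δ₁e^{−Λτ}`, and for every `0 < ν < ν₁` a history `u` with
  `CalmRecurrence ν f u U₁ δ₂ L` (every `[a, a+L]`, `a ≥ 0`, contains a good restart time `s` with
  `‖u s − U₁‖₂ ≤ δ₂`). Why it might fail = why the crux might (no smooth-data steady-forced Euler blow-up is
  known, let alone an `L²`-ball of them; `ν`-uniform deep returns to one state; see the stub docstring).
* `stub_ballTransport` (provable now, L). `BlowupBall f U₀ δ₁ T ∧ OrbitInto f U₁ U₀ τ Λ ⇒
  BlowupBall f U₁ (δ₁e^{−Λτ}) (τ+T)` — Grönwall on `½‖U_W − U‖₂²` with only the reference gradient, forces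
  cancel, then restart the putative classical solution at `τ` inside the ball at `U₀`.
* `stub_energyCeilingOfCalmVisits` (provable now, M–L). Datum and visit states in the `L²`-ball of radius `ρ`,
  a visit (good restart) in every `[a, a+L]` ⇒ `∫‖u t‖² ≤ E(‖f‖_∞, ρ, L)` for ALL `t ≥ 0`, every `ν > 0` —
  energy inequality from zero of each restart + a.e. work bound + monotone bootstrap to the fixed point of
  `K ↦ ½ρ² + L‖f‖_∞√(2K)`.

Composition `RecurrentBlowupBall_of` (sorry-free; two bookkeeping lemmas `eLpNorm_visit_le`,
`calmRecurrence_shift` + ~30 lines): the crux's exit state is the core's return target `U₁`, its ball the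
transported one (radius `δ₁e^{−Λτ} > δ₂`, time `τ + T > 0`; stub 2); at viscosity `ν` the crux's solution is
the core's history RESTARTED at its first calm visit `s₀ ∈ [0, L]` (datum `u s₀`, global Leray–Hopf by the
visit itself), which recurs calmly again (`calmRecurrence_shift`: sliding windows are translation invariant,
the restart of a restart is a restart); every visit state is the `L²` time-`0` slice of its own restart, so
`‖u s‖₂ ≤ δ₂ + ‖U₁‖₂ =: ρ < ∞` (`eLpNorm_visit_le`, `IsSmooth.memLp`); stub 3 at `(f, ρ, L)` caps
`∫‖u t‖²` for all `t ≥ 0`; the lattice windows `[kL, (k+1)L]` are sliding windows with `a = kL`. The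
conclusion is the route decl `Sparks.RecurrentBlowupBall` BY NAME (after `unfold`, its clauses are supplied
term-for-term: `BlowupBall`/`CalmRecurrence` are character-for-character the crux's conjuncts).

## Disproof / negatives honoured

No `Cruxes/RecurrentBlowupBall/Disproof.lean`, no crux idea and no `Theorems/…/Negative/` lemma exist
(`ledger crux ls stmt-AnomalousDissipation-14546`: "(no workfiles yet)", 2026-08-17) — nothing to cite. The item's
evidence is one refuter crux-attack (2026-08-16, SURVIVES, class open-problem: read-back `Iff.rfl`; the RET
restart datum `u s` is pinned and `MemLp` — no slice loophole; BALL is false at any steady classical state, so it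
is not decoration; RET alone is trivially met by constant flows when `f = 0`; the `IsSmooth V`/`IsDivFree V`
binders of BALL are redundant) and one grounder stamp (NEW/open). The skeleton keeps BALL verbatim (redundant
binders included, so that `BlowupBall` matches the crux's clause term-for-term) and never separates RET from BALL's
force (stub 1 carries both), so the constant-flow instance does not trivialise any stub. Negatives of the summit that touch this line (refuting theorems read in
`Theorems/`): GPEnergyCeiling (stmt-2979, `FrustratedForcesGPEnergyCeiling_refuted`: conserved mean momentum,
constant drifts of any energy — a UNIVERSAL `ν`-uniform ceiling is false) and EnsembleCeilingBridge (stmt-2984)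
— hence the ceiling is DERIVED from recurrence with capped visit states (stub 3), never asserted for all
solutions; RobustDecayQuantum (stmt-2859, `DebrisQuantaRobustDecayQuantum_refuted`: the `t = 0` slice of
`Torus.IsLerayHopfOn` is junk) — does not bite: every visit state here is the DATUM of its restart
(`IsGlobalLerayHopf ν f (u s) (u (s + ·))`), pinned by `strong_initial`/the weak form, and stub 3 at `t = 0` is
guarded by `energy_ineq_zero` (`KE (u 0) ≤ KE u₀`). The other three negatives (ScalarLift2halfD 14324,
CorrelationEnergyUnboundedNeg 0204, TaylorCertificatePair 13037) concern other mechanisms.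

## BC3 audit (this seat; raw outputs under `birth-certificate:` in the seat's NOTES.md and in `Lines/birth.md`)

`lean check --json` rc 0, `sorries = 3` = the three `theorem stub_*` (warnings "declaration uses `sorry`" at
exactly those three declarations, zero elsewhere; `RecurrentBlowupBall_of`, `eLpNorm_visit_le`,
`calmRecurrence_shift` sorry-free). Probes (files `bc/probe_stub_*.lean` of the seat folder: §0 vocabulary +
the stub's alias, NO sorried theorem in scope, `maxHeartbeats 400000` each): for each stub,
`stub → RecurrentBlowupBall` and `stub → AnomalousDissipation` by `first | exact? | simpa | aesop` (coarse) and
by `first | exact? | simpa [defs] | (unfold; simpa [defs]) | aesop (add norm unfold [defs])` (unfolded) — all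
12 FAIL (rc 1; unsolved goals / heartbeat timeouts); and FINE probes (`bc/probefine_stub_*.lean`: `intro h` then
ONE closer among `exact?`, `simpa using h`, `aesop`, `aesop (enableSimp := false)`, so that no timeout masks a
later closer) — all 24 FAIL (`exact?` could not close the goal · `simpa` type mismatch · `aesop` failed / made no
progress / unsolved goals after destructuring the existential). Per-probe error heads in `Lines/birth.md`.

Shape (D-0027 §3.3, as `Cruxes/RecurrentDebris/Lines/birth.lean`): registered stubs
`theorem stub_<name> : <signature> := by sorry`; name-keyed VERBATIM aliases `__Registered.stub_<name>`
(emitted from the same source string by the seat's generator `gen/make_birth.py`); composition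
`RecurrentBlowupBall_of : __Registered.stub_sparkCycleCore → __Registered.stub_ballTransport →
__Registered.stub_energyCeilingOfCalmVisits → RecurrentBlowupBall`; wiring `example`.

References: E. Bruè, C. De Lellis, *Anomalous dissipation for the forced 3D Navier–Stokes equations*, CMP 400
(2023) = arXiv:2207.06301, §1 and App. Lemma 7 [BrueDeLellis2023]; Y. Brenier, C. De Lellis, L. Székelyhidi,
CMP 305 (2011) Cor. 1 [BrenierDeLellisSzekelyhidi2011]; E. Wiedemann, *Weak–strong uniqueness in fluid
dynamics* (2018) [Wiedemann2018]; T. Kato, J. Funct. Anal. 9 (1972) [Kato1972]; P. Constantin, *On the Euler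
equations of incompressible fluids*, BAMS 44 (2007) §3 [Constantin2007]; T. Yasuda, S. Goto, G. Kawahara,
Fluid Dyn. Res. 46 (2014) 061413 [YasudaGotoKawahara2014]; S. Goto, Y. Saito, G. Kawahara, Phys. Rev. Fluids 2
(2017) [GotoSaitoKawahara2017]; L. van Veen, A. Vela-Martín, G. Kawahara, Phys. Rev. Lett. 123 (2019)
[VanVeenVelaMartinKawahara2019]; T. Elgindi, Ann. Math. 194 (2021) [Elgindi2021AnnMath]; J. Chen, T. Hou (2025)
[ChenHou2025]; D. Córdoba, L. Martínez-Zoroa, F. Zheng / arXiv:2308.12197 [CordobaMartinezZoroa2023];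
A. Cheskidov, arXiv:2311.04182 [Cheskidov2023]; C. Doering, C. Foias, JFM 467 (2002) §2 [DoeringFoias2002];
E. Hopf, Math. Nachr. 4 (1951) [Hopf1951]; G. Galdi, *An introduction to the Navier–Stokes initial-boundary
value problem* (2000) Def. 2.1 [Galdi2000]; C. Foias, O. Manley, R. Rosa, R. Temam, *Navier–Stokes Equations
and Turbulence* (2001) Ch. II [FoiasManleyRosaTemam2001].
-/

-- `Summit.<Summit>.<Problem>`: single-conjunct summit, the duplicate component is the tree's convention.
set_option linter.dupNamespace false

noncomputable section

open Filter Set MeasureTheory Topology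
open scoped ENNReal

namespace Summit.AnomalousDissipation.AnomalousDissipation.Cruxes.RecurrentBlowupBall.Birth

open Summit.AnomalousDissipation.AnomalousDissipation.Theses.Sparks


/-! ### §0 Vocabulary of the seam (transparent `def`s over tree declarations) -/

/-- **Blow-up ball** — VERBATIM the first conjunct of the crux: no smooth divergence-free `V` in the closed
`L²`-ball of radius `δ₁` about `U₀` launches a classical solution of Euler forced by the steady force `f`
on `[0, T]` (`Torus.IsClassicalNSSolutionOn (Icc 0 T) 0 (fun _ => f) U P → U 0 ≠ V`). -/
def BlowupBall (f U₀ : UnitAddTorus (Fin 3) → EuclideanSpace ℝ (Fin 3)) (δ₁ T : ℝ) : Prop :=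
  ∀ V : UnitAddTorus (Fin 3) → EuclideanSpace ℝ (Fin 3),
    Literature.Analysis.FunctionSpaces.Torus.IsSmooth V →
    Literature.Analysis.FunctionSpaces.Torus.IsDivFree V →
    MeasureTheory.eLpNorm (V - U₀) 2 MeasureTheory.volume ≤ ENNReal.ofReal δ₁ →
    ∀ (U : ℝ → UnitAddTorus (Fin 3) → EuclideanSpace ℝ (Fin 3)) (P : ℝ → UnitAddTorus (Fin 3) → ℝ),
      Literature.Analysis.FunctionSpaces.Torus.IsClassicalNSSolutionOn (Set.Icc 0 T) 0 (fun _ => f) U P →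
        U 0 ≠ V

/-- **Burst-onset orbit** — the return target `U₁` is joined to the centre `U₀` of the blow-up ball by a
CLASSICAL orbit of Euler forced by `f` of duration `τ`, with a uniform operator bound `Λ` on the velocity
gradient along it (`‖D(lift (U t)) y v‖ ≤ Λ‖v‖`; this `Λτ` is the logarithm of the `L²`-amplification the
orbit can produce, Grönwall) — or, degenerately, `τ = 0` and `U₁ = U₀` (one-state form of the crux). -/
def OrbitInto (f U₁ U₀ : UnitAddTorus (Fin 3) → EuclideanSpace ℝ (Fin 3)) (τ Λ : ℝ) : Prop :=
  (τ = 0 ∧ U₁ = U₀) ∨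
    (0 < τ ∧ ∃ (U : ℝ → UnitAddTorus (Fin 3) → EuclideanSpace ℝ (Fin 3)) (P : ℝ → UnitAddTorus (Fin 3) → ℝ),
      Literature.Analysis.FunctionSpaces.Torus.IsClassicalNSSolutionOn (Set.Icc 0 τ) 0 (fun _ => f) U P ∧
        U 0 = U₁ ∧ U τ = U₀ ∧
          ∀ t ∈ Set.Icc 0 τ, ∀ y v : EuclideanSpace ℝ (Fin 3),
            ‖fderiv ℝ (Literature.Analysis.FunctionSpaces.Torus.lift (U t)) y v‖ ≤ Λ * ‖v‖)

/-- **Calm recurrence (sliding windows, good restart times, NO energy clause, NO datum)** — the velocity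
history `u` passes, in every time interval `[a, a + L]` with `a ≥ 0`, through a time `s` at which it
RESTARTS as a global Leray–Hopf solution of `NS_ν` forced by `f` from its own value `u s` (a "good" time)
and `u s` is `δ`-close to `U₁` in `L²`. -/
def CalmRecurrence (ν : ℝ) (f : UnitAddTorus (Fin 3) → EuclideanSpace ℝ (Fin 3))
    (u : ℝ → UnitAddTorus (Fin 3) → EuclideanSpace ℝ (Fin 3)) (U₁ : UnitAddTorus (Fin 3) → EuclideanSpace ℝ (Fin 3))
    (δ L : ℝ) : Prop :=
  ∀ a : ℝ, 0 ≤ a → ∃ s ∈ Set.Icc a (a + L),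
    Literature.Analysis.FluidPDE.Torus.IsGlobalLerayHopf ν (fun _ => f) (u s) (fun t => u (s + t)) ∧
      MeasureTheory.eLpNorm (u s - U₁) 2 MeasureTheory.volume ≤ ENNReal.ofReal δ


/-! ### §1 Registered stubs (the ONLY `sorry`s of the file) -/

/-- **stub 1 — SPARK-CYCLE CORE: a robust breakdown ball DOWNSTREAM of a calmly recurrent state (the
residue of the crux; open, Euler-blow-up class ∧ long-time Navier–Stokes dynamics, size XL).** There are a
smooth steady divergence-free mean-zero force `f`, a smooth divergence-free RETURN TARGET `U₁` and BALL CENTRE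
`U₀`, joined by a burst-onset orbit (`OrbitInto f U₁ U₀ τ Λ`: a classical forced-Euler orbit of duration
`τ ≥ 0` from `U₁` to `U₀` with velocity-gradient bound `Λ`, or `τ = 0`, `U₁ = U₀`), a blow-up ball
`BlowupBall f U₀ δ₁ T` (no smooth divergence-free datum `δ₁`-close to `U₀` in `L²` launches a classical
forced-Euler solution on `[0, T]` — VERBATIM the crux's first conjunct, but at the downstream state), a window
`L > 0`, a threshold `ν₁ > 0` and a return depth `0 < δ₂ < δ₁·e^{−Λτ}` (below the `L²`-amplification the orbit
can produce) such that for EVERY viscosity `0 < ν < ν₁` some velocity history `u : ℝ → (T³ → ℝ³)` is CALMLY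
RECURRENT to `U₁` (`CalmRecurrence ν f u U₁ δ₂ L`: every interval `[a, a+L]`, `a ≥ 0`, contains a time `s` at
which `u` restarts as a GLOBAL Leray–Hopf solution of `NS_ν` forced by `f` from `u s`, with
`‖u s − U₁‖_{L²} ≤ δ₂`). Compared with the crux: NO energy ceiling (that is stub 3 — it follows from
recurrence), NO datum and NO Leray–Hopf requirement on `u` before its first visit (the composition restarts
there), sliding windows instead of the lattice `[kTr, (k+1)Tr]`, and the return target may sit UPSTREAM of
the breakdown ball along the burst (stub 2 transports the ball back to `U₁` at the explicit price
`e^{−Λτ}`; `τ = 0` is the one-state form). Intended witnesses (card sparks-recurrent-calm-forces-euler-blowup):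
`f = f_e` a Beltrami/second-shell eigen-force with exact charging branch `u = a(t)f_e`, `U₁` = the state just
after the inviscid instability of the critically charged eigenstate `A·f_e` has selected its unstable
direction, `U₀` = the developed burst state downstream, returns = burn, relaminarise, recharge, destabilise.
Why it might fail: exactly why the crux might — (i) it needs an `L²`-BALL of smooth data all breaking down
by `T` under a smooth steady force on `T³` (no smooth-data blow-up is known; Elgindi2021AnnMath /
ElgindiGhoulMasmoudi2021 need `C^{1,α}` data, ChenHou2025 a boundary, CordobaMartinezZoroa2023 a
`C^{1,1/2−}` force on `ℝ³`; known scenarios are stable only in strong norms, and `T`-tame data may be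
`L²`-dense near `U₀` — the route's cheapest falsifier); (ii) it needs `ν`-UNIFORM returns within
`δ₂ < δ₁e^{−Λτ}` of ONE state in every window (debris may never re-enter a fixed `L²`-ball; placing `U₁`
upstream near the charging branch makes the return plausible but charges the amplification `e^{Λτ}` of the
onset orbit: the exit amplitude/phase must lock to relative precision `δ₁e^{−Λτ}`). Honours the negatives
index: no universal energy ceiling is asserted (GPEnergyCeiling, stmt-2979, refuted); visit states are data
of their own restarts, hence pinned by `strong_initial` (not the junk `t = 0` slice of RobustDecayQuantum,
stmt-2859). Sources: BrueDeLellis2023 §1 (= arXiv:2207.06301; anomaly only beyond the Euler blow-up time),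
YasudaGotoKawahara2014, GotoSaitoKawahara2017, VanVeenVelaMartinKawahara2019 (quasi-cyclic steadily forced
box turbulence; the UPO as one charge–burst cycle), Elgindi2021AnnMath, ChenHou2025, CordobaMartinezZoroa2023,
Cheskidov2023 (arXiv:2311.04182), the route header of `Theses/Sparks.lean`. -/
theorem stub_sparkCycleCore :
    ∃ f : UnitAddTorus (Fin 3) → EuclideanSpace ℝ (Fin 3), Literature.Analysis.FunctionSpaces.Torus.IsSmooth f ∧ Literature.Analysis.FunctionSpaces.Torus.IsDivFree f ∧ Literature.Analysis.FunctionSpaces.Torus.HasZeroMean f ∧ ∃ (U₁ U₀ : UnitAddTorus (Fin 3) → EuclideanSpace ℝ (Fin 3)) (δ₁ δ₂ T τ Λ L ν₁ : ℝ), Literature.Analysis.FunctionSpaces.Torus.IsSmooth U₁ ∧ Literature.Analysis.FunctionSpaces.Torus.IsDivFree U₁ ∧ Literature.Analysis.FunctionSpaces.Torus.IsSmooth U₀ ∧ Literature.Analysis.FunctionSpaces.Torus.IsDivFree U₀ ∧ 0 < T ∧ 0 ≤ τ ∧ 0 ≤ Λ ∧ 0 < L ∧ 0 < ν₁ ∧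 0 < δ₂ ∧ δ₂ < δ₁ * Real.exp (-(Λ * τ)) ∧ OrbitInto f U₁ U₀ τ Λ ∧ BlowupBall f U₀ δ₁ T ∧ ∀ ν : ℝ, 0 < ν → ν < ν₁ → ∃ u : ℝ → UnitAddTorus (Fin 3) → EuclideanSpace ℝ (Fin 3), CalmRecurrence ν f u U₁ δ₂ L := by
  sorry

/-- **stub 2 — BLOW-UP BALLS PROPAGATE BACKWARDS ALONG CLASSICAL ORBITS (provable now; classical–classical
`L²` stability of forced Euler, size L).** If no smooth divergence-free datum within `δ₁` of `U₀` in `L²`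
launches a classical solution of Euler forced by `f` on `[0, T]` (`BlowupBall f U₀ δ₁ T`, `T > 0`), and `U₀` is
reached from `U₁` by a classical forced-Euler orbit `U` on `[0, τ]` with `‖D(lift (U t)) y v‖ ≤ Λ‖v‖`
(`OrbitInto f U₁ U₀ τ Λ`), then no smooth divergence-free datum within `δ₁e^{−Λτ}` of `U₁` launches a classical
solution on `[0, τ + T]` (`BlowupBall f U₁ (δ₁e^{−Λτ}) (τ + T)`). Proof in print: let `W` be such a datum and
`(U_W, P_W)` classical on `[0, τ+T]` with `U_W 0 = W`; restricted to `[0, τ]` (one-sided time derivatives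
within the smaller interval agree for jointly smooth fields) `w := U_W − U` solves
`∂ₜw + (U_W·∇)w + (w·∇)U + ∇(P_W − P) = 0` — the forces CANCEL (same steady `f`) — so
`d/dt ½‖w‖₂² = −∫(w·∇U)·w ≤ Λ‖w‖₂²` (`∫(U_W·∇w)·w = 0` by `div U_W = 0`, the pressure pairs to `0` with
`div w = 0`; `Torus.integral_inner_laplacian`-free since `ν = 0`), whence Grönwall
`‖U_W τ − U₀‖₂ ≤ e^{Λτ}‖W − U₁‖₂ ≤ δ₁`; the slice `V := U_W τ` is smooth and divergence free and
`t ↦ (U_W (τ+t), P_W (τ+t))` is classical on `[0, T]` with value `V` at `0` — contradicting the ball at `U₀`.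
The degenerate branch `τ = 0, U₁ = U₀` is `simp`. Only ONE gradient (the reference orbit's) enters, as in
weak–strong uniqueness; this is the classical sibling of the route's engine WindowStability (stmt-1186) and it
prices the freedom of stub 1 to return UPSTREAM of the breakdown: the ball shrinks by exactly the
amplification factor `e^{Λτ}` of the onset orbit. Why it might fail: it should not (for `δ₁ ≤ 0` the ball
degenerates consistently: `ofReal` of a negative radius is `0`); the Lean cost is the energy identity for the
difference of two `Torus.IsClassicalNSSolutionOn` fields (differentiation under `∫_{T³}`, the trilinear
cancellations via `Torus.IsDivFree`, restriction/translation of one-sided `timeDerivWithin`). Leans on: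
`Literature.Analysis.FunctionSpaces.Torus.IsClassicalNSSolutionOn` (+ `.energy_balance` pattern),
`Torus.IsSmoothSpaceTimeOn.isSmooth_slice`, `Torus.lift`, `gronwallBound`/`norm_le_gronwallBound_of_norm_deriv_right_le`
(Mathlib), `MeasureTheory.eLpNorm`. Sources: Wiedemann2018 (weak–strong uniqueness survey, relative energy),
BrueDeLellis2023 App. Lemma 7 (arXiv:2207.06301 p. 18), BrenierDeLellisSzekelyhidi2011 Cor. 1, Kato1972
(classical well-posedness/continuous dependence for Euler), Constantin2007 §3. -/
theorem stub_ballTransport :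
    ∀ (f U₁ U₀ : UnitAddTorus (Fin 3) → EuclideanSpace ℝ (Fin 3)) (δ₁ T τ Λ : ℝ), 0 < T → OrbitInto f U₁ U₀ τ Λ → BlowupBall f U₀ δ₁ T → BlowupBall f U₁ (δ₁ * Real.exp (-(Λ * τ))) (τ + T) := by
  sorry

/-- **stub 3 — ENERGY CEILING FROM CALM VISITS: recurrence at good restart times to an `L²`-bounded set gives a
`ν`-UNIFORM pointwise-in-time energy bound (provable now, size M–L).** For a smooth steady force `f`, a radius
`ρ < ∞` (in `ℝ≥0∞`) and a window `L > 0` there is `E = E(‖f‖_∞, ρ, L)` such that for EVERY viscosity `ν > 0`,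
every global Leray–Hopf solution `u` of `NS_ν` forced by `f` from a datum `u₀` with `‖u₀‖_{L²} ≤ ρ` which, in
every interval `[a, a+L]` (`a ≥ 0`), passes through a time `s` at which it restarts as a global Leray–Hopf
solution from `u s` with `‖u s‖_{L²} ≤ ρ`, satisfies `∫‖u t x‖² dx ≤ E` for ALL `t ≥ 0` (the crux's energy
clause, Bochner form). Proof in print: every `t ≥ 0` lies within `L` after a control time `s` (a visit in
`[t−L, t]` if `t ≥ L`, else `s = 0` with the datum); for the restart `v := u(s + ·)` the energy inequality FROM
ZERO (`IsLerayHopfOn.energy_ineq_zero`, valid at EVERY `t' ∈ [0, T]`, dissipation dropped since `ν > 0`) gives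
`½‖v t'‖₂² ≤ ½ρ² + |∫₀^{t'}∫⟪f, v⟫|`; the work integrand is a.e. bounded by `‖f‖_∞ (2K)^{1/2}` whenever
`½‖v τ‖₂² ≤ K` a.e. (`memLp` at every slice, Cauchy–Schwarz on the unit-volume torus; a non-integrable work
term has interval integral `0`), so `energy_bound` (`v ∈ L^∞_t L²_x`, some a-priori `K₀`) starts the monotone
bootstrap `K_{n+1} = ½ρ² + L‖f‖_∞(2K_n)^{1/2}`, valid POINTWISE on `[0, L]` at each stage, which decreases to
the fixed point `K* = K*(ρ, L, ‖f‖_∞)`; hence `∫‖u t‖² = 2·KE(u t) ≤ 2K* =: E`, independent of `ν` and of the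
solution. This is the precise sense in which the crux's (and the summit's) bounded-energy clause is a
CONSEQUENCE of deep recurrence, not an extra assumption — in contrast with the refuted UNIVERSAL ceilings
GPEnergyCeiling (stmt-2979: conserved mean momentum, constant drifts of arbitrary energy) and
EnsembleCeilingBridge (stmt-2984); here momentum is capped at every visit. Junk-safe at `t = 0`
(`KE (u 0) ≤ KE u₀` by `energy_ineq_zero`; cf. RobustDecayQuantum, stmt-2859). Why it might fail: it should
not; the Lean work is the a-priori finiteness at EVERY slice and the junk cases of the Bochner/interval
integrals. Leans on: `Literature.Analysis.FluidPDE.Torus.IsLerayHopfOn.{energy_ineq_zero, energy_bound, memLp}`,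
`Literature.Analysis.FunctionSpaces.Torus.kineticEnergy(_nonneg)`, `IsSmooth.continuous` (‖f‖_∞),
`MeasureTheory.norm_setIntegral_le_of_norm_le_const`, `MemLp.eLpNorm_eq_integral_rpow_norm`-type identities,
`intervalIntegral`. Sources: DoeringFoias2002 §2 (energy bookkeeping of body-forced flow), Hopf1951,
Galdi2000 Def. 2.1, FoiasManleyRosaTemam2001 Ch. II (absorbing balls), the sibling skeleton
`Cruxes/RecurrentDebris/Lines/birth.lean` (stub_energyBetweenVisits). -/
theorem stub_energyCeilingOfCalmVisits :
    ∀ f : UnitAddTorus (Fin 3) → EuclideanSpace ℝ (Fin 3), Literature.Analysis.FunctionSpaces.Torus.IsSmooth f → ∀ (ρ : ENNReal) (L : ℝ), ρ ≠ ⊤ → 0 < L → ∃ E : ℝ, ∀ (ν : ℝ) (u₀ : UnitAddTorus (Fin 3) → EuclideanSpace ℝ (Fin 3)) (u : ℝ → UnitAddTorus (Fin 3) → EuclideanSpace ℝ (Fin 3)), 0 < ν → Literature.Analysis.FluidPDE.Torus.IsGlobalLerayHopf ν (fun _ => f) u₀ u → MeasureTheory.eLpNorm u₀ 2 MeasureTheory.volume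 ≤ ρ → (∀ a : ℝ, 0 ≤ a → ∃ s ∈ Set.Icc a (a + L), Literature.Analysis.FluidPDE.Torus.IsGlobalLerayHopf ν (fun _ => f) (u s) (fun t => u (s + t)) ∧ MeasureTheory.eLpNorm (u s) 2 MeasureTheory.volume ≤ ρ) → ∀ t : ℝ, 0 ≤ t → MeasureTheory.integral MeasureTheory.volume (fun x => ‖u t x‖ ^ 2) ≤ E := by
  sorry

/-! ### §2 Name-keyed aliases of the three stub statements — the hypotheses of `RecurrentBlowupBall_of`

The native skeleton audit (`#h21_check_skeleton`, run by `ledger skeleton check`) admits a hypothesis of the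
composing theorem only if its head constant is a registered obligation or is NAMED like a declared stub;
`__Registered.stub_X` is the statement of `stub_X` VERBATIM under the stub's short name (device of
`Cruxes/RecurrentDebris/Lines/birth.lean`, `Cruxes/CyclicWindLineLoud/Lines/birth.lean`; the `__` namespace is an
implementation detail, so the audit's stub report resolves each `stub_…` to the sorried theorem above, not to
its alias). Each alias is an `abbrev`, textually its stub's signature (both emitted from one source string). -/
namespace __Registered

/-- Alias of the statement of `stub_sparkCycleCore`, keyed by the stub name (verbatim). -/
abbrev stub_sparkCycleCore : Prop :=
  ∃ f : UnitAddTorus (Fin 3) → EuclideanSpace ℝ (Fin 3), Literature.Analysis.FunctionSpaces.Torus.IsSmooth f ∧ Literature.Analysis.FunctionSpaces.Torus.IsDivFree f ∧ Literature.Analysis.FunctionSpaces.Torus.HasZeroMean f ∧ ∃ (U₁ U₀ : UnitAddTorus (Fin 3) → EuclideanSpace ℝ (Fin 3)) (δ₁ δ₂ T τ Λ L ν₁ : ℝ), Literature.Analysis.FunctionSpaces.Torus.IsSmooth U₁ ∧ Literature.Analysis.FunctionSpaces.Torus.IsDivFree U₁ ∧ Literature.Analysis.FunctionSpaces.Torus.IsSmooth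 U₀ ∧ Literature.Analysis.FunctionSpaces.Torus.IsDivFree U₀ ∧ 0 < T ∧ 0 ≤ τ ∧ 0 ≤ Λ ∧ 0 < L ∧ 0 < ν₁ ∧ 0 < δ₂ ∧ δ₂ < δ₁ * Real.exp (-(Λ * τ)) ∧ OrbitInto f U₁ U₀ τ Λ ∧ BlowupBall f U₀ δ₁ T ∧ ∀ ν : ℝ, 0 < ν → ν < ν₁ → ∃ u : ℝ → UnitAddTorus (Fin 3) → EuclideanSpace ℝ (Fin 3), CalmRecurrence ν f u U₁ δ₂ L

/-- Alias of the statement of `stub_ballTransport`, keyed by the stub name (verbatim). -/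
abbrev stub_ballTransport : Prop :=
  ∀ (f U₁ U₀ : UnitAddTorus (Fin 3) → EuclideanSpace ℝ (Fin 3)) (δ₁ T τ Λ : ℝ), 0 < T → OrbitInto f U₁ U₀ τ Λ → BlowupBall f U₀ δ₁ T → BlowupBall f U₁ (δ₁ * Real.exp (-(Λ * τ))) (τ + T)

/-- Alias of the statement of `stub_energyCeilingOfCalmVisits`, keyed by the stub name (verbatim). -/
abbrev stub_energyCeilingOfCalmVisits : Prop :=
  ∀ f : UnitAddTorus (Fin 3) → EuclideanSpace ℝ (Fin 3), Literature.Analysis.FunctionSpaces.Torus.IsSmooth f → ∀ (ρ : ENNReal) (L : ℝ), ρ ≠ ⊤ → 0 < L → ∃ E : ℝ, ∀ (ν : ℝ) (u₀ : UnitAddTorus (Fin 3) → EuclideanSpace ℝ (Fin 3)) (u : ℝ → UnitAddTorus (Fin 3) → EuclideanSpace ℝ (Fin 3)), 0 < ν → Literature.Analysis.FluidPDE.Torus.IsGlobalLerayHopf ν (fun _ => f) u₀ u → MeasureTheory.eLpNorm u₀ 2 MeasureTheory.volume ≤ ρ → (∀ a : ℝ, 0 ≤ a → ∃ s ∈ Set.Icc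 a (a + L), Literature.Analysis.FluidPDE.Torus.IsGlobalLerayHopf ν (fun _ => f) (u s) (fun t => u (s + t)) ∧ MeasureTheory.eLpNorm (u s) 2 MeasureTheory.volume ≤ ρ) → ∀ t : ℝ, 0 ≤ t → MeasureTheory.integral MeasureTheory.volume (fun x => ‖u t x‖ ^ 2) ≤ E

end __Registered

/-! ### §3 Composition (kernel-checked; no `sorry` outside the three stubs) -/

/-- A calm visit state lies in the `L²`-ball of radius `δ + ‖U₁‖₂`: it is the (square-integrable) time-`0`
slice of its own restart, so the triangle inequality in `L²` applies. [bookkeeping] -/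
theorem eLpNorm_visit_le {ν δ : ℝ} {f U₁ w : UnitAddTorus (Fin 3) → EuclideanSpace ℝ (Fin 3)}
    {v : ℝ → UnitAddTorus (Fin 3) → EuclideanSpace ℝ (Fin 3)}
    (hU₁ : Literature.Analysis.FunctionSpaces.Torus.IsSmooth U₁)
    (hv : Literature.Analysis.FluidPDE.Torus.IsGlobalLerayHopf ν (fun _ => f) w v) (h0 : v 0 = w)
    (hcl : MeasureTheory.eLpNorm (w - U₁) 2 MeasureTheory.volume ≤ ENNReal.ofReal δ) :
    MeasureTheory.eLpNorm w 2 MeasureTheory.volume ≤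
      ENNReal.ofReal δ + MeasureTheory.eLpNorm U₁ 2 MeasureTheory.volume := by
  have hU₁m : MeasureTheory.AEStronglyMeasurable U₁ MeasureTheory.volume :=
    hU₁.continuous.aestronglyMeasurable
  have hw : MeasureTheory.AEStronglyMeasurable w MeasureTheory.volume := by
    have hm : MeasureTheory.MemLp (v 0) 2 MeasureTheory.volume :=
      (hv 1 one_pos).memLp 0 ⟨le_rfl, zero_le_one⟩
    rw [h0] at hm
    exact hm.aestronglyMeasurable
  calc MeasureTheory.eLpNorm w 2 MeasureTheory.volume
      = MeasureTheory.eLpNorm ((w - U₁) + U₁) 2 MeasureTheory.volume := by rw [sub_add_cancel]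
    _ ≤ MeasureTheory.eLpNorm (w - U₁) 2 MeasureTheory.volume +
          MeasureTheory.eLpNorm U₁ 2 MeasureTheory.volume :=
        MeasureTheory.eLpNorm_add_le (hw.sub hU₁m) hU₁m (by norm_num)
    _ ≤ ENNReal.ofReal δ + MeasureTheory.eLpNorm U₁ 2 MeasureTheory.volume := add_le_add hcl le_rfl

/-- Restarting a calmly recurrent history at one of its visit times `s₀ ≥ 0` gives a calmly recurrent
history again (sliding windows are translation invariant; the restart of a restart is a restart).
[bookkeeping] -/
theorem calmRecurrence_shift {ν δ L : ℝ} {f U₁ : UnitAddTorus (Fin 3) → EuclideanSpace ℝ (Fin 3)}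
    {u : ℝ → UnitAddTorus (Fin 3) → EuclideanSpace ℝ (Fin 3)} (hu : CalmRecurrence ν f u U₁ δ L)
    {s₀ : ℝ} (hs₀ : 0 ≤ s₀) :
    CalmRecurrence ν f (fun t => u (s₀ + t)) U₁ δ L := by
  intro a ha
  obtain ⟨s, hs, hLH, hcl⟩ := hu (s₀ + a) (by linarith)
  have h2 : s₀ + (s - s₀) = s := by ring
  have h1 : (fun t => u (s₀ + (s - s₀ + t))) = fun t => u (s + t) := by
    funext t; congr 1; ring
  refine ⟨s - s₀, ⟨by linarith [hs.1], by linarith [hs.2]⟩, ?_, ?_⟩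
  · show Literature.Analysis.FluidPDE.Torus.IsGlobalLerayHopf ν (fun _ => f) (u (s₀ + (s - s₀)))
      (fun t => u (s₀ + (s - s₀ + t)))
    rw [h1, h2]; exact hLH
  · show MeasureTheory.eLpNorm (u (s₀ + (s - s₀)) - U₁) 2 MeasureTheory.volume ≤ ENNReal.ofReal δ
    rw [h2]; exact hcl

set_option maxHeartbeats 800000 in
/-- **The skeleton closes the crux BY NAME**:
`stub_sparkCycleCore → stub_ballTransport → stub_energyCeilingOfCalmVisits → Sparks.RecurrentBlowupBall`
(hypotheses = the name-keyed aliases `__Registered.stub_*`). The return target `U₁` of the core becomes the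
crux's exit state; its blow-up ball is the ball at `U₀` transported backwards along the burst-onset orbit
(radius `δ₁e^{-Λτ}`, time `τ + T`; stub 2); the crux's solution at viscosity `ν` is the core's history
RESTARTED at its first calm visit `s₀ ∈ [0, L]` (datum `u s₀`, `δ₂`-close to `U₁`), whose energy is capped
for all `t ≥ 0` by stub 3 fed with the shifted visits (radius `ρ = δ₂ + ‖U₁‖₂` by the triangle inequality);
the crux's windows `[kTr, (k+1)Tr]`, `Tr := L`, are among the sliding windows. -/
theorem RecurrentBlowupBall_of :
    __Registered.stub_sparkCycleCore → __Registered.stub_ballTransport →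
      __Registered.stub_energyCeilingOfCalmVisits → RecurrentBlowupBall := by
  intro hCore hTrans hCeil
  obtain ⟨f, hf, hfd, hfm, U₁, U₀, δ₁, δ₂, T, τ, Λ, L, ν₁, hU₁, hU₁d, hU₀, hU₀d, hT, hτ, hΛ, hL, hν₁,
    hδ₂, hδ₂₁, hOrb, hBall, hRec⟩ := hCore
  -- Stub 2: the blow-up ball at the return target `U₁`.
  have hBall₁ : BlowupBall f U₁ (δ₁ * Real.exp (-(Λ * τ))) (τ + T) :=
    hTrans f U₁ U₀ δ₁ T τ Λ hT hOrb hBall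
  -- Stub 3: the ν-uniform energy ceiling for histories recurring to the `L²`-ball of radius `ρ`.
  have hρtop : ENNReal.ofReal δ₂ + MeasureTheory.eLpNorm U₁ 2 MeasureTheory.volume ≠ ⊤ :=
    ENNReal.add_ne_top.2 ⟨ENNReal.ofReal_ne_top, (hU₁.memLp 2).eLpNorm_lt_top.ne⟩
  obtain ⟨E, hE⟩ :=
    hCeil f hf (ENNReal.ofReal δ₂ + MeasureTheory.eLpNorm U₁ 2 MeasureTheory.volume) L hρtop hL
  have hτT : 0 < τ + T := by linarith
  unfold Summit.AnomalousDissipation.AnomalousDissipation.Theses.Sparks.RecurrentBlowupBall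
  refine ⟨f, hf, hfd, hfm, U₁, δ₁ * Real.exp (-(Λ * τ)), δ₂, τ + T, E, L, ν₁, hU₁, hU₁d, hδ₂, hδ₂₁,
    hτT, hL, hν₁, hBall₁, ?_⟩
  intro ν hν hνlt
  obtain ⟨u, hu⟩ := hRec ν hν hνlt
  -- the first calm visit `s₀ ∈ [0, L]`: restart there; the restarted history recurs calmly again
  obtain ⟨s₀, hs₀, hLH₀, hclose₀⟩ := hu 0 le_rfl
  have shifted := calmRecurrence_shift hu hs₀.1
  refine ⟨u s₀, fun t => u (s₀ + t), hLH₀, ?_, ?_⟩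
  · -- energy ceiling (stub 3) for the restarted history
    refine hE ν (u s₀) (fun t => u (s₀ + t)) hν hLH₀ (eLpNorm_visit_le hU₁ hLH₀ (by simp) hclose₀) ?_
    intro a ha
    obtain ⟨s, hs, hLH, hcl⟩ := shifted a ha
    exact ⟨s, hs, hLH, eLpNorm_visit_le hU₁ hLH (by simp) hcl⟩
  · -- deep return in the windows `[kL, (k+1)L]`
    intro k
    obtain ⟨s, hs, hLH, hcl⟩ := shifted ((k : ℝ) * L) (by positivity)
    exact ⟨s, ⟨hs.1, by linarith [hs.2]⟩, hLH, hcl⟩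

/-- WIRING CHECK: the three sorried stubs compose to a closed term of the crux's type (modulo their
`sorry`s). Deliberately an `example` (no constant enters the environment). -/
example : RecurrentBlowupBall :=
  RecurrentBlowupBall_of stub_sparkCycleCore stub_ballTransport stub_energyCeilingOfCalmVisits

end Summit.AnomalousDissipation.AnomalousDissipation.Cruxes.RecurrentBlowupBall.Birth

end
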